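import Summits.ResolutionOfSingularities.ResolutionOfSingularities.Theorems.PurelyInseparableDim4ChartChainShapeT
import Summits.ResolutionOfSingularities.ResolutionOfSingularities.Theorems.PurelyInseparableDim4ChartChainMonotone
import HarnessLib

/-!
# Purely inseparable four-folds `z^p + F(x₁, …, x₄)`: chains `S.erase j ⊆ S₁ ⊆ S₂ ⊆ …` are multiple blow-ups,
# UNCONDITIONALLY (brick TY-2 (h) part 7c of cell `res-dim4-pi`)

[OURS · counted 0] (D-0157 DOOR 2; director-resolution DR-157-C; frame `PIDim4.TerminationImpliesOrderReduction`,
S3 (c); desk caveat FC-1). Sequel of `PurelyInseparableDim4ChartChainShapeT.lean` (translated boundary shape) and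
`PurelyInseparableDim4ChartChainMonotone.lean` (fully monotone chains). The first step of a branch may DROP the
chart variable (`S.erase j ⊆ S₁`, e.g. «blow up the point, then the transversal curve»): the old exceptional
divisor then reads a translated hyperplane `V(x_j + c)` on later charts and may meet later centres — the translated
shape handles exactly this. PROVED here (no `sorry`, no new axiom):

* **`chainT_start`** — depth 1 for `S` Hironaka-permissible, ANY blowing up along `V(z, x_S)`, `j ∈ S`, `b_j = 0`:
  the INVARIANT-T (multiple blow-up, `HasSNC`, chart reading `(z^p + s₁.F)·𝒪`, closedness, TRANSLATED SHAPE with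
  injective index) relative to EVERY `S₁ ⊇ S.erase j`;
* **`chainT_step`** — INVARIANT-T(Z, φ, M, s, S') + `p ≤ ord_{(x_{S'})} s.F` ⇒ for ANY blowing up along `Z_c` and
  every `j' ∈ S'`, `b'`: `IsMultipleBlowup` one level deeper, `HasSNC`, and a chart of the chart with INVARIANT-T
  relative to EVERY `S'' ⊇ S'` — the simple-normal-crossings input DERIVED (`hasSNCWith_globalCentre_of_shapeT`).

So every finite branch `S.erase j ⊆ S₁ ⊆ S₂ ⊆ …` of the walk, read through ANY choices of the blowings up, is a
BGMW `IsMultipleBlowup` of `(𝔸⁵, (z^p + F)·𝒪, [], p)` with its last transform reading `(z^p + s_n.F)·𝒪` on a chart,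
with NO hypothesis beyond the walk's permissibility of each centre. Nothing here is a statement about resolution of
singularities in dimension ≥ 4 / characteristic `p` (NOT proved anywhere in this programme). bears_on:
LADDER-RESOLUTION:D157-DOOR2 (res-dim4-pi). Supports stmt-ResolutionOfSingularities-16155 (helper, TY-2 (h)).
-/

-- every declaration of this summit lives under `Summit.ResolutionOfSingularities.ResolutionOfSingularities`
-- (summit = problem), which the duplicate-namespace linter flags; house convention (cf. the Target file).
set_option linter.dupNamespace false

noncomputable section

open MvPolynomial Finset CategoryTheory AlgebraicGeometry Opposite TopologicalSpace
open AlgebraicGeometry.Scheme.IdealSheafData (ofIdealTop vanishingIdeal)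

namespace Summit.ResolutionOfSingularities.ResolutionOfSingularities.Theorems.PIDim4

open Literature.AlgebraicGeometry.Resolution
open Literature.AlgebraicGeometry.Resolution.AffinePointBlowup (P A γ coord Wtop)

namespace ChartDictionary

section StepT

variable {K : Type} [Field K] {p : ℕ} [Fact p.Prime] [CharP K p] [PerfectRing K p] [DecidableEq K]
  {X₀ Z W₂ : Scheme.{0}} (φ : P 4 K ⟶ Z) [IsOpenImmersion φ] {π₂ : W₂ ⟶ Z} {S' : Finset (Fin 4)} {j' : Fin 4}

/-- **THE UNCONDITIONAL STEP with the translated shape.** From INVARIANT-T(Z, φ, M, s₁, S') — `IsMultipleBlowup M₀ σ M`,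
`HasSNC M.boundary`, `M` (multiplicity `p`) reads `(z^p + s₁.F)·𝒪` on `φ`, `φ(V(z, x_{S'}))` closed, and the TRANSLATED
SHAPE of `M.boundary` relative to `(φ, S')` with injective index — and `p ≤ ord_{(x_{S'})} s₁.F`: for ANY blowing up `π₂`
along `Z_c` and every `j' ∈ S'`, `b'` (`b'_{j'} = 0`): `IsMultipleBlowup M₀ (π₂ ≫ σ) M₂`, `HasSNC M₂.boundary`, and a chart
of the chart `φ''` with `M₂|_{φ''} = (z^p + (step p S' j' b' s₁).F)·𝒪` and INVARIANT-T(W₂, φ'', M₂, ·, S'') for EVERY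
`S'' ⊇ S'`. -/
theorem chainT_step [IsLocallyNoetherian Z] {M₀ : MarkedIdeal X₀} {σ : Z ⟶ X₀} {M : MarkedIdeal Z}
    (hσ : IsMultipleBlowup M₀ σ M) (hE : HasSNC M.boundary) (hmult : M.mult = p) (s₁ : State K)
    (hM : M.ideal.comap φ = hypSheaf p s₁.F)
    (hperm' : (p : ℕ∞) ≤ CentreBlowup.ordAlong S' s₁.F)
    (hT : IsClosed (φ '' (AffineCoordBlowup.CΛ 4 K (insert 0 (Fin.succ '' (S' : Set (Fin 4)))) : Set (P 4 K))))
    (idx : Z.IdealSheafData → Fin 4) (cst : Z.IdealSheafData → K)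
    (hshape : ∀ D ∈ M.boundary,
      ((D.support : Set Z) ∩ φ '' (AffineCoordBlowup.CΛ 4 K (insert 0 (Fin.succ '' (S' : Set (Fin 4)))) : Set (P 4 K))).Nonempty →
      D.comap φ = ofIdealTop (Ideal.span {(γ 4 K).symm (X (idx D).succ + C (cst D))}) ∧ (idx D ∈ S' → cst D = 0))
    (hinj : ∀ D₁ ∈ M.boundary, ∀ D₂ ∈ M.boundary,
      ((D₁.support : Set Z) ∩ φ '' (AffineCoordBlowup.CΛ 4 K (insert 0 (Fin.succ '' (S' : Set (Fin 4)))) : Set (P 4 K))).Nonempty →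
      ((D₂.support : Set Z) ∩ φ '' (AffineCoordBlowup.CΛ 4 K (insert 0 (Fin.succ '' (S' : Set (Fin 4)))) : Set (P 4 K))).Nonempty →
      idx D₁ = idx D₂ → D₁ = D₂)
    (hπ₂ : IsBlowup π₂ (vanishingIdeal (closureImage φ
      ((AffineCoordBlowup.𝓘Λ 4 K (insert 0 (Fin.succ '' (S' : Set (Fin 4))))).support : Set (P 4 K)))))
    (hj' : j' ∈ S') {b' : Fin 4 → K} (hbj' : b' j' = 0) :
    IsMultipleBlowup M₀ (π₂ ≫ σ) (M.transform π₂ (vanishingIdeal (closureImage φ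
        ((AffineCoordBlowup.𝓘Λ 4 K (insert 0 (Fin.succ '' (S' : Set (Fin 4))))).support : Set (P 4 K))))) ∧
      HasSNC (M.transform π₂ (vanishingIdeal (closureImage φ
        ((AffineCoordBlowup.𝓘Λ 4 K (insert 0 (Fin.succ '' (S' : Set (Fin 4))))).support : Set (P 4 K))))).boundary ∧
      ∃ (Θ' : A 4 K ≃ₐ[K] A 4 K) (h' : MvPolynomial (Fin 4) K),
        Θ' (X 0) = X 0 + rename Fin.succ h' ∧ (∀ i : Fin 4, Θ' (X i.succ) = X i.succ + C (b' i)) ∧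
        (M.transform π₂ (vanishingIdeal (closureImage φ
          ((AffineCoordBlowup.𝓘Λ 4 K (insert 0 (Fin.succ '' (S' : Set (Fin 4))))).support : Set (P 4 K))))).ideal.comap
          (Spec.map (CommRingCat.ofHom (Θ' : A 4 K →+* A 4 K)) ≫
            AffineCoordBlowup.chartImm (isBlowup_restrict_globalCentre φ _ hπ₂) (succ_mem_centreVars hj') ≫
              (π₂ ⁻¹ᵁ φ.opensRange).ι) =
          hypSheaf p (CentreBlowup.step p S' j' b' s₁).F ∧
        ∀ S'' : Finset (Fin 4), S' ⊆ S'' →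
          IsClosed ((Spec.map (CommRingCat.ofHom (Θ' : A 4 K →+* A 4 K)) ≫
              AffineCoordBlowup.chartImm (isBlowup_restrict_globalCentre φ _ hπ₂) (succ_mem_centreVars hj') ≫
                (π₂ ⁻¹ᵁ φ.opensRange).ι) ''
            (AffineCoordBlowup.CΛ 4 K (insert 0 (Fin.succ '' (S'' : Set (Fin 4)))) : Set (P 4 K))) ∧
          ∃ (idx₂ : W₂.IdealSheafData → Fin 4) (cst₂ : W₂.IdealSheafData → K),
            (∀ D₂ ∈ (M.transform π₂ (vanishingIdeal (closureImage φ
                ((AffineCoordBlowup.𝓘Λ 4 K (insert 0 (Fin.succ '' (S' : Set (Fin 4))))).support : Set (P 4 K))))).boundary,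
              ((D₂.support : Set W₂) ∩ (Spec.map (CommRingCat.ofHom (Θ' : A 4 K →+* A 4 K)) ≫
                  AffineCoordBlowup.chartImm (isBlowup_restrict_globalCentre φ _ hπ₂) (succ_mem_centreVars hj') ≫
                    (π₂ ⁻¹ᵁ φ.opensRange).ι) ''
                (AffineCoordBlowup.CΛ 4 K (insert 0 (Fin.succ '' (S'' : Set (Fin 4)))) : Set (P 4 K))).Nonempty →
              D₂.comap (Spec.map (CommRingCat.ofHom (Θ' : A 4 K →+* A 4 K)) ≫
                  AffineCoordBlowup.chartImm (isBlowup_restrict_globalCentre φ _ hπ₂) (succ_mem_centreVars hj') ≫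
                    (π₂ ⁻¹ᵁ φ.opensRange).ι) =
                ofIdealTop (Ideal.span {(γ 4 K).symm (X (idx₂ D₂).succ + C (cst₂ D₂))}) ∧ (idx₂ D₂ ∈ S'' → cst₂ D₂ = 0)) ∧
            (∀ D₁ ∈ (M.transform π₂ (vanishingIdeal (closureImage φ
                ((AffineCoordBlowup.𝓘Λ 4 K (insert 0 (Fin.succ '' (S' : Set (Fin 4))))).support : Set (P 4 K))))).boundary,
              ∀ D₂ ∈ (M.transform π₂ (vanishingIdeal (closureImage φ
                ((AffineCoordBlowup.𝓘Λ 4 K (insert 0 (Fin.succ '' (S' : Set (Fin 4))))).support : Set (P 4 K))))).boundary,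
              ((D₁.support : Set W₂) ∩ (Spec.map (CommRingCat.ofHom (Θ' : A 4 K →+* A 4 K)) ≫
                  AffineCoordBlowup.chartImm (isBlowup_restrict_globalCentre φ _ hπ₂) (succ_mem_centreVars hj') ≫
                    (π₂ ⁻¹ᵁ φ.opensRange).ι) ''
                (AffineCoordBlowup.CΛ 4 K (insert 0 (Fin.succ '' (S'' : Set (Fin 4)))) : Set (P 4 K))).Nonempty →
              ((D₂.support : Set W₂) ∩ (Spec.map (CommRingCat.ofHom (Θ' : A 4 K →+* A 4 K)) ≫
                  AffineCoordBlowup.chartImm (isBlowup_restrict_globalCentre φ _ hπ₂) (succ_mem_centreVars hj') ≫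
                    (π₂ ⁻¹ᵁ φ.opensRange).ι) ''
                (AffineCoordBlowup.CΛ 4 K (insert 0 (Fin.succ '' (S'' : Set (Fin 4)))) : Set (P 4 K))).Nonempty →
              idx₂ D₁ = idx₂ D₂ → D₁ = D₂) := by
  haveI : IsProper π₂ := hπ₂.isProper
  haveI : IsLocallyNoetherian W₂ := LocallyOfFiniteType.isLocallyNoetherian π₂
  have hEc := hasSNCWith_globalCentre_of_shapeT φ hT hE idx cst hshape hinj
  obtain ⟨Θ', h', h0', hs', hc⟩ := transform_ideal_chart_of_chart φ M hmult s₁ hM hπ₂ hj' hbj' hperm'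
  refine ⟨IsMultipleBlowup.blowup hσ _ π₂ hπ₂ (isRegular_globalCentre φ hT)
      (support_globalCentre_subset_support φ hT hmult hM hperm') hEc,
    MarkedIdeal.hasSNC_transform_boundary M hEc hπ₂, Θ', h', h0', hs', hc, fun S'' hsub => ⟨?_, ?_⟩⟩
  · exact isClosed_image_CΛ_chart_of_chart φ hT hπ₂ hj' hbj' h0' hs' hsub
  · rw [MarkedIdeal.transform_boundary]
    exact shapeT_transform φ hT hπ₂ hj' hbj' hs' hsub idx cst hshape hinj

end StepT

/-! ## The base: depth one, `S.erase j ⊆ S₁` -/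

section StartT

variable {K : Type} [Field K] {p : ℕ} [Fact p.Prime] [CharP K p] [PerfectRing K p] [DecidableEq K]
  {S : Finset (Fin 4)} {j : Fin 4} {b : Fin 4 → K} {F : MvPolynomial (Fin 4) K} {W : Scheme.{0}} {π : W ⟶ P 4 K}

/-- **DEPTH ONE with the translated shape.** For `S` Hironaka-permissible for `z^p + F`, ANY blowing up `π : W → 𝔸⁵_K`
along `V(z, x_S)`, `j ∈ S`, `b_j = 0`: `IsMultipleBlowup M₀ π M₁`, `HasSNC M₁.boundary`, a re-centred chart `φ` on which
`M₁` reads `(z^p + s₁.F)·𝒪`, and for EVERY `S₁ ⊇ S.erase j`: `φ(V(z, x_{S₁}))` is closed and the boundary `[E]` has the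
TRANSLATED SHAPE (index `j`, constant `0`; injectivity trivial) — INVARIANT-T(W, φ, M₁, s₁, S₁). -/
theorem chainT_start (hS : IsPermissibleCentre p S F)
    (hπ : IsBlowup π (AffineCoordBlowup.𝓘Λ 4 K (insert 0 (Fin.succ '' (S : Set (Fin 4)))))) (hj : j ∈ S)
    (hbj : b j = 0) :
    IsMultipleBlowup (⟨hypSheaf p F, [], p⟩ : MarkedIdeal (P 4 K)) π
        ((⟨hypSheaf p F, [], p⟩ : MarkedIdeal (P 4 K)).transform π
          (AffineCoordBlowup.𝓘Λ 4 K (insert 0 (Fin.succ '' (S : Set (Fin 4)))))) ∧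
      HasSNC ((⟨hypSheaf p F, [], p⟩ : MarkedIdeal (P 4 K)).transform π
          (AffineCoordBlowup.𝓘Λ 4 K (insert 0 (Fin.succ '' (S : Set (Fin 4)))))).boundary ∧
      ∃ (Θ : A 4 K ≃ₐ[K] A 4 K) (h : MvPolynomial (Fin 4) K),
        Θ (X 0) = X 0 + rename Fin.succ h ∧ (∀ i : Fin 4, Θ (X i.succ) = X i.succ + C (b i)) ∧
        (((⟨hypSheaf p F, [], p⟩ : MarkedIdeal (P 4 K)).transform π
            (AffineCoordBlowup.𝓘Λ 4 K (insert 0 (Fin.succ '' (S : Set (Fin 4)))))).ideal).comap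
          (Spec.map (CommRingCat.ofHom (Θ : A 4 K →+* A 4 K)) ≫ AffineCoordBlowup.chartImm hπ (succ_mem_centreVars hj)) =
          hypSheaf p (CentreBlowup.step p S j b (⟨F, 0, ∅⟩ : State K)).F ∧
        ∀ S₁ : Finset (Fin 4), S.erase j ⊆ S₁ →
          IsClosed ((Spec.map (CommRingCat.ofHom (Θ : A 4 K →+* A 4 K)) ≫
              AffineCoordBlowup.chartImm hπ (succ_mem_centreVars hj)) ''
            (AffineCoordBlowup.CΛ 4 K (insert 0 (Fin.succ '' (S₁ : Set (Fin 4)))) : Set (P 4 K))) ∧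
          ∃ (idx : W.IdealSheafData → Fin 4) (cst : W.IdealSheafData → K),
            (∀ D ∈ ((⟨hypSheaf p F, [], p⟩ : MarkedIdeal (P 4 K)).transform π
                (AffineCoordBlowup.𝓘Λ 4 K (insert 0 (Fin.succ '' (S : Set (Fin 4)))))).boundary,
              ((D.support : Set W) ∩ (Spec.map (CommRingCat.ofHom (Θ : A 4 K →+* A 4 K)) ≫
                  AffineCoordBlowup.chartImm hπ (succ_mem_centreVars hj)) ''
                (AffineCoordBlowup.CΛ 4 K (insert 0 (Fin.succ '' (S₁ : Set (Fin 4)))) : Set (P 4 K))).Nonempty →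
              D.comap (Spec.map (CommRingCat.ofHom (Θ : A 4 K →+* A 4 K)) ≫
                  AffineCoordBlowup.chartImm hπ (succ_mem_centreVars hj)) =
                ofIdealTop (Ideal.span {(γ 4 K).symm (X (idx D).succ + C (cst D))}) ∧ (idx D ∈ S₁ → cst D = 0)) ∧
            (∀ D₁ ∈ ((⟨hypSheaf p F, [], p⟩ : MarkedIdeal (P 4 K)).transform π
                (AffineCoordBlowup.𝓘Λ 4 K (insert 0 (Fin.succ '' (S : Set (Fin 4)))))).boundary,
              ∀ D₂ ∈ ((⟨hypSheaf p F, [], p⟩ : MarkedIdeal (P 4 K)).transform π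
                (AffineCoordBlowup.𝓘Λ 4 K (insert 0 (Fin.succ '' (S : Set (Fin 4)))))).boundary,
              ((D₁.support : Set W) ∩ (Spec.map (CommRingCat.ofHom (Θ : A 4 K →+* A 4 K)) ≫
                  AffineCoordBlowup.chartImm hπ (succ_mem_centreVars hj)) ''
                (AffineCoordBlowup.CΛ 4 K (insert 0 (Fin.succ '' (S₁ : Set (Fin 4)))) : Set (P 4 K))).Nonempty →
              ((D₂.support : Set W) ∩ (Spec.map (CommRingCat.ofHom (Θ : A 4 K →+* A 4 K)) ≫
                  AffineCoordBlowup.chartImm hπ (succ_mem_centreVars hj)) ''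
                (AffineCoordBlowup.CΛ 4 K (insert 0 (Fin.succ '' (S₁ : Set (Fin 4)))) : Set (P 4 K))).Nonempty →
              idx D₁ = idx D₂ → D₁ = D₂) := by
  haveI : IsProper π := hπ.isProper
  haveI : IsLocallyNoetherian W := LocallyOfFiniteType.isLocallyNoetherian π
  obtain ⟨Θ, h, h0, hs, hI⟩ := transform_ideal_chart_eq_step p hj hbj (⟨F, 0, ∅⟩ : State K) hS.2 [] hπ
  have hΘj : (Θ : A 4 K →+* A 4 K) (X j.succ) = X j.succ := by
    rw [show (Θ : A 4 K →+* A 4 K) (X j.succ) = Θ (X j.succ) from rfl, hs j, hbj, C_0, add_zero]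
  refine ⟨isMultipleBlowup_single_of_isPermissibleCentre p hS hπ,
    MarkedIdeal.hasSNC_transform_boundary _ (hasSNCWith_nil_𝓘Λ _) hπ, Θ, h, h0, hs, hI, fun S₁ hsub => ⟨?_, ?_⟩⟩
  · exact isClosed_image_CΛ_chart hj hbj h0 hs hπ hsub
  · refine ⟨fun _ => j, fun _ => 0, fun D hD _ => ⟨?_, fun _ => rfl⟩, fun D₁ hD₁ D₂ hD₂ _ _ _ => ?_⟩
    · rw [MarkedIdeal.transform_boundary, List.map_nil, List.nil_append, List.mem_singleton] at hD
      subst hD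
      rw [C_0, add_zero, comap_exceptional_chart hj hΘj hπ]
      rfl
    · rw [MarkedIdeal.transform_boundary, List.map_nil, List.nil_append, List.mem_singleton] at hD₁ hD₂
      rw [hD₁, hD₂]

end StartT

end ChartDictionary

end Summit.ResolutionOfSingularities.ResolutionOfSingularities.Theorems.PIDim4

end
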